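import Literature.NumberTheory.EllipticCurves.IsogenySelmerGroups
import Literature.NumberTheory.EllipticCurves.ShaIsogenyProofs
import Literature.NumberTheory.EllipticCurves.KummerMap
import Literature.NumberTheory.EllipticCurves.SelmerProofs
import Literature.NumberTheory.EllipticCurves.IsogenyMordellWeilRankProofs
import Literature.NumberTheory.EllipticCurves.MordellWeilTheoremProofs
import HarnessLib

/-!
# The Kummer sequence of an isogeny and Silverman's Theorem X.4.2(a) for `φ`-Selmer groups

Proofs-only file (theorems only: no definition, no named fact) of topic
`NumberTheory/EllipticCurves`, on the way to the named fact
`WeierstrassCurve.bsdRHS_eq_of_isIsogenous` (Cassels 1965 / Milne *ADT* I.7.3): the input (7.3.1)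
of Milne's proof is the Selmer-group count of an isogeny (Cassels' formula), whose first
ingredient is the exact sequence of Silverman, *AEC*, Thm. X.4.2(a),
`0 → E'(K)/φ(E(K)) → S^{(φ)}(E/K) → Ш(E/K)[φ] → 0`
for an isogeny `φ : E → E'` of elliptic curves over a number field, `Ш(E/K)[φ] = ker Ш(φ)`.
The tree had this for `φ = [n]` only (`KummerMap.lean`, `SelmerProofs.lean`,
`WeierstrassCurve.natCard_selmerGroup_eq`); `IsogenySelmerGroups.lean` defines
`WeierstrassCurve.Isogeny.selmerGroup`, and `IsogenySelmerGroupsCompositeProofs.lean` proves its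
finiteness (`Isogeny.finite_selmerGroup`, via BKLOS Lemma 9.1) but not the count. This file proves,
for the tree's honest continuous Galois cohomology:

* `Literature.NumberTheory.EllipticCurves.range_resH1Hom_incl_eq_ker` — for a surjective
  equivariant map `f : M → M'` of discrete `G`-modules with open stabilisers and an equivariant
  injection `ι : A → M` onto `ker f`, the sequence `H¹(G, A) → H¹(G, M) → H¹(G, M')` is exact
  (cocycle-level proof, as `exists_map_torsionIncl_eq` of `SelmerProofs.lean` for `M[n] ↪ M →ⁿ M`).
* `WeierstrassCurve.Isogeny.range_kerH1ToH1_eq_ker_galH1Map` — **the Kummer sequence of an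
  isogeny**: `H¹(K, E[φ]) → H¹(K, E) → H¹(K, E')` is exact (Silverman X.§4, sequence (*):
  `H¹(K, E[φ]) → WC(E/K)[φ] → 0`).
* `WeierstrassCurve.Isogeny.selmerGroup_eq_comap_sha` — `S^{(φ)}(E/K)` is the preimage of `Ш(E/K)`
  under `H¹(K, E[φ]) → H¹(K, E)` (commutativity of Silverman's diagram (**)).
* `WeierstrassCurve.Isogeny.exists_kummerMap` — the connecting homomorphism
  `δ : E'(K) → H¹(K, E[φ])`, `P ↦ [σ ↦ σQ − Q]` (`φQ = P`), with `ker δ = φ(E(K))` and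
  `im δ = S^{(φ)}(E/K) ∩ ker (H¹(K, E[φ]) → H¹(K, E))`.
* `WeierstrassCurve.Isogeny.natCard_selmerGroup_eq` — **X.4.2(a) for `φ`, counting form**:
  `#S^{(φ)}(E/K) = [E'(K) : φ(E(K))] · #ker Ш(φ)`; `index_range_pointHom_ne_zero`
  (`[E'(K) : φ(E(K))]` is finite) and `finite_selmerGroup'` (X.4.2(b) again, now from the count and
  for `K` in any universe; the tree's `Isogeny.finite_selmerGroup` has `K : Type`).

The map `H¹(K, E[φ]) → H¹(K, E)` is written `resH1Hom id (E[φ] ↪ E(K̄))` throughout (no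
abbreviation is introduced); `E[φ]` carries the action `Isogeny.kerAction` (supplied by `letI`, as in
`IsogenySelmerGroups.lean`). The map on rational points `φ(K)` enters as data `f` with its
characterising property `hf` (`Isogeny.exists_pointHom`), as in the Cassels files.

## References

* [SilvermanAEC2009] J. H. Silverman, *The Arithmetic of Elliptic Curves*, 2nd ed., VIII.§2
  (Kummer sequence), X.§4 pp. 331–333 (sequence (*), diagram (**), Thm. X.4.2 (a), (b)).
* [MilneADT2006] J. S. Milne, *Arithmetic Duality Theorems*, 2nd ed., I.§7, proof of Thm. 7.3.
-/

noncomputable section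

open scoped Classical

universe u

/-! ## §0 Exactness of `H¹(G, A) → H¹(G, M) → H¹(G, M')` for discrete modules -/

namespace Literature.NumberTheory.EllipticCurves

open Literature.NumberTheory.GaloisRepresentations

section Generic

variable {G : Type u} [Group G] [TopologicalSpace G] [IsTopologicalGroup G]
variable {M : Type u} [AddCommGroup M] [DistribMulAction G M] [TopologicalSpace M]
  [DiscreteTopology M]
variable {M' : Type u} [AddCommGroup M'] [DistribMulAction G M'] [TopologicalSpace M']
  [DiscreteTopology M']
variable {A : Type u} [AddCommGroup A] [DistribMulAction G A] [TopologicalSpace A]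
  [DiscreteTopology A]

/-- **Exactness of `H¹(G, A) → H¹(G, M) → H¹(G, M')` at `H¹(G, M)`, surjectivity onto the
kernel.** Let `f : M → M'` be a surjective `G`-equivariant homomorphism of discrete `G`-modules,
`M` with open stabilisers, and `ι : A → M` an injective equivariant homomorphism whose image
contains `ker f`. Then every class `ξ ∈ H¹(G, M)` killed by `H¹(f)` comes from `H¹(G, A)`.
Cocycle-level proof: `ξ = [c]`, `f ∘ c = ∂v'`, `v' = f v`; then `c − ∂v` takes values in
`ker f = ι(A)` and has the same class. Silverman, *AEC*, VIII.§2 and X.§4 (proof of X.4.2(a):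
"note that `P^σ − P ∈ E[φ]`"); Serre, *Galois Cohomology*, I.§2.2.
[cite: SilvermanAEC2009, Appendix B Prop. B.2.3 (long exact sequence; exactness at H¹(G, M))] -/
theorem exists_resH1Hom_incl_eq_of_resH1Hom_eq_zero (f : M →+ M')
    (hf : ∀ (g : G) (m : M), f (ContinuousMonoidHom.id G g • m) = g • f m)
    (hsurj : Function.Surjective f)
    (hst : ∀ m : M, IsOpen (MulAction.stabilizer G m : Set G))
    (ι : A →+ M) (hι : ∀ (g : G) (a : A), ι (ContinuousMonoidHom.id G g • a) = g • ι a)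
    (hinj : Function.Injective ι) (hker : ∀ m : M, f m = 0 → ∃ a : A, ι a = m)
    (ξ : discreteH1 G M) (hξ : resH1Hom (ContinuousMonoidHom.id G) f hf ξ = 0) :
    ∃ ζ : discreteH1 G A, resH1Hom (ContinuousMonoidHom.id G) ι hι ζ = ξ := by
  obtain ⟨c, rfl⟩ := oneCocycleClass_surjective (discreteTopRep G M) ξ
  -- `f ∘ c` is principal: `f (c g) = g • v' - v'`
  rw [resH1Hom_id_oneCocycleClass, oneCocycleClass_eq_zero_iff] at hξ
  obtain ⟨v', hv'⟩ := hξ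
  obtain ⟨v, rfl⟩ := hsurj v'
  obtain ⟨π, hπ⟩ := exists_contOneCocycles_apply_eq_smul_sub v (hst v)
  -- the corrected cocycle `c - π` takes values in `ker f`
  have hf' : ∀ (g : G) (m : M), f (g • m) = g • f m := hf
  have hψ : ∀ g, f ((c - π).1 g) = 0 := fun g ↦ by
    have h := hv' g
    change f (c.1 g) = g • f v - f v at h
    change f (c.1 g - π.1 g) = 0
    rw [map_sub, h, hπ, map_sub, hf', sub_self]
  -- lift it to an `A`-valued continuous crossed homomorphism
  choose s hs using fun g ↦ hker _ (hψ g)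
  let ψA : contOneCocycles (discreteTopRep G A) := contOneCocycles.lift ι hι hinj (c - π) s hs
  refine ⟨oneCocycleClass _ ψA, ?_⟩
  rw [resH1Hom_id_oneCocycleClass]
  have hpush : contOneCocycles.push ι hι ψA = c - π := by
    apply Subtype.ext
    ext g
    exact hs g
  rw [hpush, oneCocycleClass_sub, sub_eq_self, oneCocycleClass_eq_zero_iff]
  exact ⟨v, hπ⟩

omit [IsTopologicalGroup G] in
/-- `H¹(f) ∘ H¹(ι) = 0` when `f ∘ ι = 0` (functoriality: the composite is `H¹` of the zero pair,
which kills every cocycle). Serre, *Galois Cohomology*, I.§2.4.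
[cite: SilvermanAEC2009, Appendix B Prop. B.2.3 (long exact sequence: the composite H¹(G, P) → H¹(G, N) is zero)] -/
theorem resH1Hom_resH1Hom_incl_eq_zero [IsTopologicalGroup G] (f : M →+ M')
    (hf : ∀ (g : G) (m : M), f (ContinuousMonoidHom.id G g • m) = g • f m)
    (ι : A →+ M) (hι : ∀ (g : G) (a : A), ι (ContinuousMonoidHom.id G g • a) = g • ι a)
    (hfι : ∀ a, f (ι a) = 0) (ζ : discreteH1 G A) :
    resH1Hom (ContinuousMonoidHom.id G) f hf (resH1Hom (ContinuousMonoidHom.id G) ι hι ζ) = 0 := by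
  obtain ⟨c, rfl⟩ := oneCocycleClass_surjective (discreteTopRep G A) ζ
  rw [resH1Hom_id_oneCocycleClass, resH1Hom_id_oneCocycleClass, oneCocycleClass_eq_zero_iff]
  refine ⟨0, fun g ↦ ?_⟩
  change f (ι (c.1 g)) = g • (0 : M') - 0
  rw [hfι, smul_zero, sub_zero]

/-- **Exactness of `H¹(G, A) → H¹(G, M) → H¹(G, M')`**: under the hypotheses of
`exists_resH1Hom_incl_eq_of_resH1Hom_eq_zero` (and `f ∘ ι = 0`), the image of `H¹(ι)` is the
kernel of `H¹(f)` — the degree-one piece of the long exact cohomology sequence of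
`0 → A → M → M' → 0`. Serre, *Galois Cohomology*, I.§2.2; Silverman, *AEC*, VIII.§2, X.§4 (*).
[cite: SilvermanAEC2009, Appendix B Prop. B.2.3 (long exact sequence; exactness at H¹(G, M))] -/
theorem range_resH1Hom_incl_eq_ker (f : M →+ M')
    (hf : ∀ (g : G) (m : M), f (ContinuousMonoidHom.id G g • m) = g • f m)
    (hsurj : Function.Surjective f)
    (hst : ∀ m : M, IsOpen (MulAction.stabilizer G m : Set G))
    (ι : A →+ M) (hι : ∀ (g : G) (a : A), ι (ContinuousMonoidHom.id G g • a) = g • ι a)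
    (hinj : Function.Injective ι) (hfι : ∀ a, f (ι a) = 0)
    (hker : ∀ m : M, f m = 0 → ∃ a : A, ι a = m) :
    (resH1Hom (ContinuousMonoidHom.id G) ι hι).range =
      (resH1Hom (ContinuousMonoidHom.id G) f hf).ker := by
  ext ξ
  constructor
  · rintro ⟨ζ, rfl⟩
    exact resH1Hom_resH1Hom_incl_eq_zero f hf ι hι hfι ζ
  · intro hξ
    exact exists_resH1Hom_incl_eq_of_resH1Hom_eq_zero f hf hsurj hst ι hι hinj hker ξ hξ

end Generic

end Literature.NumberTheory.EllipticCurves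

/-! ## §1 The Kummer sequence of an isogeny: `H¹(K, E[φ]) → H¹(K, E) → H¹(K, E')` is exact -/

namespace WeierstrassCurve

namespace Isogeny

open Literature.NumberTheory.EllipticCurves Literature.NumberTheory.GaloisRepresentations

variable {K : Type u} [Field K] {W W' : WeierstrassCurve K}

/-- **The Kummer sequence of an isogeny** (Silverman, *AEC*, X.§4, sequence (*):
`0 → E[φ] → E(K̄) →^φ E'(K̄) → 0` gives `… → H¹(K, E[φ]) → H¹(K, E) →^{φ} H¹(K, E')`, i.e.
`H¹(K, E[φ]) ↠ WC(E/K)[φ] = ker (H¹(K, E) → H¹(K, E'))`). For an isogeny `φ : E → E'` of elliptic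
curves over `K` (so `φ` is onto `E'(K̄)`, `Isogeny.surjective`, AEC II.2.3 / III.4.2(a)), the image
of `H¹(K, E[φ]) → H¹(K, E)` is exactly the kernel of `H¹(φ) : H¹(K, E) → H¹(K, E')`
(`galH1Map`). [cite: SilvermanAEC2009, X.§4 sequence (*) (p. 331) and VIII.§2] -/
theorem range_kerH1ToH1_eq_ker_galH1Map [W.IsElliptic] [W'.IsElliptic] (φ : Isogeny W W') :
    letI := φ.kerAction
    (resH1Hom (ContinuousMonoidHom.id (Field.absoluteGaloisGroup K)) φ.toAddMonoidHom.ker.subtype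
        (fun _ _ ↦ rfl)).range =
      (galH1Map φ.toAddMonoidHom φ.equivariant).ker := by
  letI := φ.kerAction
  exact range_resH1Hom_incl_eq_ker φ.toAddMonoidHom φ.equivariant φ.surjective
    (isOpen_stabilizer_point_holds W) φ.toAddMonoidHom.ker.subtype (fun _ _ ↦ rfl)
    Subtype.val_injective (fun a ↦ a.2) (fun m hm ↦ ⟨⟨m, hm⟩, rfl⟩)


/-! ## §2 `S^{(φ)}(E/K)` is the preimage of `Ш(E/K)` (Silverman's diagram (**)) -/

section Comap

variable (φ : Isogeny W W') (E : Type u) [Field E] [Algebra K E]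

/-- **Commutativity of Silverman's diagram (**) for `E[φ]`**: the composite
`H¹(K, E[φ]) → H¹(K, E) → H¹(E, E(K̄_E))` is the map along the composite compatible pair
`(resGal E, pointsMap ∘ (E[φ] ↪ E(K̄)))` defining the local condition `Isogeny.selmerLocalKer`
(functoriality, Mathlib's `ContinuousCohomology.map_comp`; the `[n]`-case is
`torsionH1ToH1_comp_localRestriction` of `SelmerImage.lean`).
[cite: SilvermanAEC2009, X.§4 diagram (**) (p. 332)] -/
theorem kerH1ToH1_comp_localRestriction :
    open CategoryTheory in
    letI := φ.kerAction
    ContinuousCohomology.map (ContinuousMonoidHom.id (Field.absoluteGaloisGroup K))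
      (resHomOfEquivariant (ContinuousMonoidHom.id (Field.absoluteGaloisGroup K))
        φ.toAddMonoidHom.ker.subtype (fun _ _ ↦ rfl)) 1 ≫ W.localRestriction E =
    ContinuousCohomology.map (resGal (K := K) E)
      (resHomOfEquivariant (resGal (K := K) E) ((pointsMap W E).comp φ.toAddMonoidHom.ker.subtype)
        (fun σ P ↦ pointsMap_smul W E σ (P : W.geomPoints))) 1 := by
  rw [localRestriction, ← ContinuousCohomology.map_comp]
  rfl

/-- The local condition of `S^{(φ)}` at `E` is the preimage of the local condition of `Ш` at `E`
under `H¹(K, E[φ]) → H¹(K, E)`. [cite: SilvermanAEC2009, X.§4 diagram (**) (p. 332)] -/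
theorem selmerLocalKer_eq_comap :
    letI := φ.kerAction
    φ.selmerLocalKer E = (W.localRestrictionKer E).comap
      (resH1Hom (ContinuousMonoidHom.id (Field.absoluteGaloisGroup K)) φ.toAddMonoidHom.ker.subtype
        (fun _ _ ↦ rfl)) := by
  letI := φ.kerAction
  ext c
  rw [AddSubgroup.mem_comap, mem_localRestrictionKer_iff]
  change (ContinuousCohomology.map (resGal (K := K) E)
      (resHomOfEquivariant (resGal (K := K) E) ((pointsMap W E).comp φ.toAddMonoidHom.ker.subtype)
        (fun σ P ↦ pointsMap_smul W E σ (P : W.geomPoints))) 1).hom c = 0 ↔ _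
  rw [← kerH1ToH1_comp_localRestriction]
  rfl

/-- **`S^{(φ)}(E/K)` is the preimage of `Ш(E/K)` under `H¹(K, E[φ]) → H¹(K, E)`** over a number
field (both are cut out by vanishing in `H¹(K_v, E)` at every place, and (**) commutes).
[cite: SilvermanAEC2009, X.§4 (definitions of S^(φ), Ш and diagram (**), p. 332)] -/
theorem selmerGroup_eq_comap_sha [NumberField K] :
    letI := φ.kerAction
    φ.selmerGroup = W.sha.comap
      (resH1Hom (ContinuousMonoidHom.id (Field.absoluteGaloisGroup K)) φ.toAddMonoidHom.ker.subtype
        (fun _ _ ↦ rfl)) := by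
  simp only [selmerGroup, sha, AddSubgroup.comap_inf, AddSubgroup.comap_iInf,
    selmerLocalKer_eq_comap]

end Comap

/-! ## §3 The connecting homomorphism `δ : E'(K) → H¹(K, E[φ])` -/

section Kummer

variable (φ : Isogeny W W')

/-- For `Q ∈ E(K̄)` with `φ Q` fixed by `Γ_K`, `σ • Q - Q ∈ E[φ]`. Silverman, *AEC*, X.§4, proof of
Prop. 4.1 / Thm. 4.2 ("note that `P^σ − P ∈ E[φ]`").
[cite: SilvermanAEC2009, X.§4 proof of Thm. 4.2 (p. 333, "P^σ − P ∈ E[φ]")] -/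
theorem smul_sub_mem_ker {Q : W.geomPoints}
    (hQ : ∀ σ : Field.absoluteGaloisGroup K, σ • φ Q = φ Q) (σ : Field.absoluteGaloisGroup K) :
    σ • Q - Q ∈ φ.toAddMonoidHom.ker := by
  rw [AddMonoidHom.mem_ker, coe_toAddMonoidHom, map_sub, φ.map_smul, hQ σ, sub_self]

/-- **The Kummer cocycle of `φ`**: for `Q ∈ E(K̄)` with `φ Q ∈ E'(K̄)^{Γ_K}` there is a continuous
crossed homomorphism `Γ_K → E[φ]` with values `σ ↦ σ • Q - Q` (the coboundary of `Q` in the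
discrete module `E(K̄)`, `cobCocycle`, with values restricted to `E[φ]`, `contOneCocycles.lift`).
Silverman, *AEC*, X.§4 p. 331 (`δ(P)(σ) = Q^σ − Q`).
[cite: SilvermanAEC2009, X.§4 sequence (*) (p. 331) with Appendix B Prop. B.2.3 (connecting homomorphism δ)] -/
theorem exists_kummerCocycle {Q : W.geomPoints}
    (hQ : ∀ σ : Field.absoluteGaloisGroup K, σ • φ Q = φ Q) :
    letI := φ.kerAction
    ∃ c : contOneCocycles (discreteTopRep (Field.absoluteGaloisGroup K) φ.toAddMonoidHom.ker),
      ∀ σ, ((c.1 σ : φ.toAddMonoidHom.ker) : W.geomPoints) = σ • Q - Q := by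
  letI := φ.kerAction
  exact ⟨contOneCocycles.lift φ.toAddMonoidHom.ker.subtype (fun _ _ ↦ rfl) Subtype.val_injective
    (cobCocycle Q (continuous_smul_geomPoints W Q)) (fun σ ↦ ⟨σ • Q - Q, φ.smul_sub_mem_ker hQ σ⟩)
    (fun _ ↦ rfl), fun _ ↦ rfl⟩

/-- The class of a Kummer cocycle of `Q` vanishes iff `Q` is `Γ_K`-fixed up to `E[φ]`.
Silverman, *AEC*, X.§4 (exactness of (*) at `E'(K)/φE(K)`).
[cite: SilvermanAEC2009, X.§4 sequence (*) (p. 331) with Appendix B Prop. B.2.3 (exactness at H⁰(G, N))] -/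
theorem kummerClass_eq_zero_iff {Q : W.geomPoints}
    (c : letI := φ.kerAction
      contOneCocycles (discreteTopRep (Field.absoluteGaloisGroup K) φ.toAddMonoidHom.ker))
    (hc : ∀ σ, ((c.1 σ : φ.toAddMonoidHom.ker) : W.geomPoints) = σ • Q - Q) :
    letI := φ.kerAction
    oneCocycleClass _ c = 0 ↔
      ∃ T ∈ φ.toAddMonoidHom.ker, ∀ σ : Field.absoluteGaloisGroup K, σ • (Q - T) = Q - T := by
  letI := φ.kerAction
  rw [oneCocycleClass_eq_zero_iff]
  constructor
  · rintro ⟨v, hv⟩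
    refine ⟨v.1, v.2, fun σ ↦ ?_⟩
    have h := congrArg Subtype.val (hv σ)
    change ((c.1 σ : φ.toAddMonoidHom.ker) : W.geomPoints) = σ • (v : W.geomPoints) - v at h
    rw [hc] at h
    rw [smul_sub, sub_eq_sub_iff_sub_eq_sub, h]
  · rintro ⟨T, hT, hfix⟩
    refine ⟨⟨T, hT⟩, fun σ ↦ Subtype.ext ?_⟩
    change ((c.1 σ : φ.toAddMonoidHom.ker) : W.geomPoints) = σ • T - T
    have h := hfix σ
    rw [smul_sub, sub_eq_sub_iff_sub_eq_sub] at h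
    rw [hc, h]

/-- Kummer classes depend only on `φ Q`: cocycles for `Q`, `Q'` with `φ Q = φ Q'` have the same
class (their difference is the coboundary of `Q' - Q ∈ E[φ]`). Silverman, *AEC*, X.§4 (`δ` is
well defined). [cite: SilvermanAEC2009, X.§4 sequence (*) (p. 331) with Appendix B Prop. B.2.3 (δ well defined)] -/
theorem kummerClass_eq_of_apply_eq {Q Q' : W.geomPoints}
    (c c' : letI := φ.kerAction
      contOneCocycles (discreteTopRep (Field.absoluteGaloisGroup K) φ.toAddMonoidHom.ker))
    (hc : ∀ σ, ((c.1 σ : φ.toAddMonoidHom.ker) : W.geomPoints) = σ • Q - Q)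
    (hc' : ∀ σ, ((c'.1 σ : φ.toAddMonoidHom.ker) : W.geomPoints) = σ • Q' - Q')
    (h : φ Q = φ Q') :
    letI := φ.kerAction
    oneCocycleClass _ c = oneCocycleClass _ c' := by
  letI := φ.kerAction
  rw [← sub_eq_zero, ← oneCocycleClass_sub, oneCocycleClass_eq_zero_iff]
  have hT : Q - Q' ∈ φ.toAddMonoidHom.ker := by
    rw [AddMonoidHom.mem_ker, coe_toAddMonoidHom, map_sub, h, sub_self]
  refine ⟨⟨Q - Q', hT⟩, fun σ ↦ Subtype.ext ?_⟩
  change ((c.1 σ - c'.1 σ : φ.toAddMonoidHom.ker) : W.geomPoints) =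
    σ • (Q - Q') - (Q - Q')
  rw [AddSubgroupClass.coe_sub, hc, hc', smul_sub]
  abel

/-- Kummer classes add: if `c, c', c''` are Kummer cocycles of `Q, Q', Q + Q'` then
`[c''] = [c] + [c']`. [cite: SilvermanAEC2009, X.§4 sequence (*) (p. 331) with Appendix B Prop. B.2.3 (δ is a homomorphism)] -/
theorem kummerClass_add {Q Q' : W.geomPoints}
    (c c' c'' : letI := φ.kerAction
      contOneCocycles (discreteTopRep (Field.absoluteGaloisGroup K) φ.toAddMonoidHom.ker))
    (hc : ∀ σ, ((c.1 σ : φ.toAddMonoidHom.ker) : W.geomPoints) = σ • Q - Q)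
    (hc' : ∀ σ, ((c'.1 σ : φ.toAddMonoidHom.ker) : W.geomPoints) = σ • Q' - Q')
    (hc'' : ∀ σ, ((c''.1 σ : φ.toAddMonoidHom.ker) : W.geomPoints) = σ • (Q + Q') - (Q + Q')) :
    letI := φ.kerAction
    oneCocycleClass _ c'' = oneCocycleClass _ c + oneCocycleClass _ c' := by
  letI := φ.kerAction
  rw [← oneCocycleClass_add]
  congr 1
  apply Subtype.ext
  ext σ : 1
  apply Subtype.ext
  change ((c''.1 σ : φ.toAddMonoidHom.ker) : W.geomPoints) =
    ((c.1 σ + c'.1 σ : φ.toAddMonoidHom.ker) : W.geomPoints)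
  rw [AddMemClass.coe_add, hc, hc', hc'', smul_add]
  abel

/-- A Kummer class dies in `H¹(K, E)`: its image is the class of the coboundary of `Q`.
Silverman, *AEC*, X.§4 (exactness of (*) at `H¹(K, E[φ])`).
[cite: SilvermanAEC2009, X.§4 sequence (*) (p. 331) with Appendix B Prop. B.2.3 (composite H⁰(G, N) → H¹(G, P) → H¹(G, M) is zero)] -/
theorem resH1Hom_kummerClass_eq_zero {Q : W.geomPoints}
    (c : letI := φ.kerAction
      contOneCocycles (discreteTopRep (Field.absoluteGaloisGroup K) φ.toAddMonoidHom.ker))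
    (hc : ∀ σ, ((c.1 σ : φ.toAddMonoidHom.ker) : W.geomPoints) = σ • Q - Q) :
    letI := φ.kerAction
    resH1Hom (ContinuousMonoidHom.id (Field.absoluteGaloisGroup K)) φ.toAddMonoidHom.ker.subtype
      (fun _ _ ↦ rfl) (oneCocycleClass _ c) = 0 := by
  letI := φ.kerAction
  rw [resH1Hom_id_oneCocycleClass, oneCocycleClass_eq_zero_iff]
  exact ⟨Q, fun σ ↦ hc σ⟩

variable {E : Type u} [Field E] [Algebra K E]

/-- A Kummer class satisfies the local condition at every `K`-field `E`: its image in
`H¹(E, E(K̄_E))` is the class of the coboundary of `ι(Q)`. Silverman, *AEC*, X.§4 (diagram (**)).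
[cite: SilvermanAEC2009, X.§4 diagram (**) (p. 332)] -/
theorem kummerClass_mem_selmerLocalKer (E : Type u) [Field E] [Algebra K E] {Q : W.geomPoints}
    (c : letI := φ.kerAction
      contOneCocycles (discreteTopRep (Field.absoluteGaloisGroup K) φ.toAddMonoidHom.ker))
    (hc : ∀ σ, ((c.1 σ : φ.toAddMonoidHom.ker) : W.geomPoints) = σ • Q - Q) :
    letI := φ.kerAction
    oneCocycleClass _ c ∈ φ.selmerLocalKer E := by
  letI := φ.kerAction
  unfold selmerLocalKer
  rw [oneCocycleClass_mem_resKer_iff]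
  refine ⟨pointsMap W E Q, fun x ↦ ?_⟩
  change pointsMap W E ((c.1 (resGal (K := K) E x) : φ.toAddMonoidHom.ker) : W.geomPoints) = _
  rw [hc, map_sub, pointsMap_smul]

/-- **Exactness of (*) at `H¹(K, E[φ])`**: a class killed by `H¹(K, E[φ]) → H¹(K, E)` is a Kummer
class of some `Q ∈ E(K̄)` with `φ Q ∈ E'(K)` (over a perfect field: `φ Q` is `Γ_K`-fixed, hence
rational by Galois descent). Silverman, *AEC*, X.§4 sequence (*).
[cite: SilvermanAEC2009, X.§4 sequence (*) (p. 331) with Appendix B Prop. B.2.3 (exactness at H¹(G, P))] -/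
theorem exists_kummerCocycle_of_resH1Hom_eq_zero [PerfectField K]
    (ξ : letI := φ.kerAction; φ.galH1Ker)
    (hξ : letI := φ.kerAction
      resH1Hom (ContinuousMonoidHom.id (Field.absoluteGaloisGroup K)) φ.toAddMonoidHom.ker.subtype
        (fun _ _ ↦ rfl) ξ = 0) :
    letI := φ.kerAction
    ∃ (P : W'.toAffine.Point) (Q : W.geomPoints)
      (c : contOneCocycles (discreteTopRep (Field.absoluteGaloisGroup K) φ.toAddMonoidHom.ker)),
      φ Q = W'.toGeomPoints P ∧
        (∀ σ, ((c.1 σ : φ.toAddMonoidHom.ker) : W.geomPoints) = σ • Q - Q) ∧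
        oneCocycleClass _ c = ξ := by
  letI := φ.kerAction
  obtain ⟨c, rfl⟩ := oneCocycleClass_surjective _ ξ
  rw [resH1Hom_id_oneCocycleClass, oneCocycleClass_eq_zero_iff] at hξ
  obtain ⟨Q, hQ⟩ := hξ
  have hc : ∀ σ, ((c.1 σ : φ.toAddMonoidHom.ker) : W.geomPoints) = σ • Q - Q := hQ
  have hfix : ∀ σ : Field.absoluteGaloisGroup K, σ • φ Q = φ Q := fun σ ↦ by
    rw [← φ.map_smul, ← sub_eq_zero, ← map_sub, ← hc σ]
    exact (c.1 σ).2
  obtain ⟨P, hP⟩ := exists_toGeomPoints_eq_of_forall_smul_eq W' hfix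
  exact ⟨P, Q, c, hP.symm, hc, rfl⟩

/-- **The connecting homomorphism `δ : E'(K) → H¹(K, E[φ])` of the Kummer sequence of `φ`, with
its kernel and image** (Silverman, *AEC*, X.§4, Prop. 4.1 / sequence (*) and Thm. 4.2(a),
injectivity half): for an isogeny `φ : E → E'` of elliptic curves over a number field and the
induced map `f = φ(K) : E(K) → E'(K)` on rational points, there is a homomorphism
`δ : E'(K) → H¹(K, E[φ])`, `P ↦ [σ ↦ σQ − Q]` (`φ Q = P`; `φ` is onto `E'(K̄)`), with
`ker δ = φ(E(K))` and `im δ = S^{(φ)}(E/K) ∩ ker (H¹(K, E[φ]) → H¹(K, E))`.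
[cite: SilvermanAEC2009, X.§4 Prop. 4.1, sequence (*), Thm. 4.2(a) (pp. 331–333)] -/
theorem exists_kummerMap [NumberField K] [W.IsElliptic] [W'.IsElliptic]
    (f : W.toAffine.Point →+ W'.toAffine.Point)
    (hf : ∀ P, W'.toGeomPoints (f P) = φ (W.toGeomPoints P)) :
    letI := φ.kerAction
    ∃ δ : W'.toAffine.Point →+ φ.galH1Ker,
      δ.ker = f.range ∧
        δ.range = φ.selmerGroup ⊓
          (resH1Hom (ContinuousMonoidHom.id (Field.absoluteGaloisGroup K))
            φ.toAddMonoidHom.ker.subtype (fun _ _ ↦ rfl)).ker := by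
  letI := φ.kerAction
  -- roots: `φ (root P) = P`
  choose root hroot using fun P : W'.toAffine.Point ↦ φ.surjective (W'.toGeomPoints P)
  have hfix : ∀ (P : W'.toAffine.Point) (σ : Field.absoluteGaloisGroup K),
      σ • φ (root P) = φ (root P) := fun P σ ↦ by rw [hroot, smul_toGeomPoints]
  -- Kummer cocycles of the roots
  choose c hc using fun P : W'.toAffine.Point ↦ φ.exists_kummerCocycle (hfix P)
  -- the map, additive because classes depend only on `φ Q` and add
  let δ : W'.toAffine.Point →+ φ.galH1Ker :=
    AddMonoidHom.mk' (fun P ↦ oneCocycleClass _ (c P)) fun P P' ↦ by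
      obtain ⟨c'', hc''⟩ := φ.exists_kummerCocycle (Q := root P + root P') (fun σ ↦ by
        rw [map_add, smul_add, hfix, hfix])
      have h1 : oneCocycleClass _ (c (P + P')) = oneCocycleClass _ c'' :=
        φ.kummerClass_eq_of_apply_eq (c (P + P')) c'' (hc (P + P')) hc''
          (by rw [hroot, map_add, map_add, hroot, hroot])
      change oneCocycleClass _ (c (P + P')) = oneCocycleClass _ (c P) + oneCocycleClass _ (c P')
      rw [h1]
      exact φ.kummerClass_add (c P) (c P') c'' (hc P) (hc P') hc''
  have hδ : ∀ P, δ P = oneCocycleClass _ (c P) := fun _ ↦ rfl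
  refine ⟨δ, ?_, le_antisymm ?_ ?_⟩
  · -- kernel
    ext P
    rw [AddMonoidHom.mem_ker, hδ, φ.kummerClass_eq_zero_iff (c P) (hc P), AddMonoidHom.mem_range]
    constructor
    · rintro ⟨T, hT, hfixT⟩
      obtain ⟨R, hR⟩ := exists_toGeomPoints_eq_of_forall_smul_eq W hfixT
      refine ⟨R, toGeomPoints_injective W' ?_⟩
      have hT0 : φ T = 0 := by
        rw [AddMonoidHom.mem_ker, coe_toAddMonoidHom] at hT
        exact hT
      rw [hf, hR, map_sub, hT0, sub_zero, hroot]
    · rintro ⟨R, rfl⟩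
      refine ⟨root (f R) - W.toGeomPoints R, ?_, fun σ ↦ ?_⟩
      · rw [AddMonoidHom.mem_ker, coe_toAddMonoidHom, map_sub, hroot, hf, sub_self]
      · rw [sub_sub_cancel, smul_toGeomPoints]
  · -- image ⊆
    rintro _ ⟨P, rfl⟩
    refine ⟨(φ.mem_selmerGroup_iff _).mpr ⟨fun v ↦ ?_, fun w ↦ ?_⟩, ?_⟩
    · exact φ.kummerClass_mem_selmerLocalKer _ (c P) (hc P)
    · exact φ.kummerClass_mem_selmerLocalKer _ (c P) (hc P)
    · exact φ.resH1Hom_kummerClass_eq_zero (c P) (hc P)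
  · -- image ⊇
    rintro ξ ⟨-, hξ⟩
    obtain ⟨P, Q, c', hQ, hc', rfl⟩ := φ.exists_kummerCocycle_of_resH1Hom_eq_zero ξ hξ
    refine ⟨P, ?_⟩
    rw [hδ]
    exact φ.kummerClass_eq_of_apply_eq (c P) c' (hc P) hc' (by rw [hroot, hQ])

end Kummer

/-! ## §4 Silverman X.4.2 for `φ`: `#S^{(φ)}(E/K) = [E'(K) : φE(K)] · #ker Ш(φ)`, finiteness -/

section Count

variable [NumberField K] [W.IsElliptic] [W'.IsElliptic] (φ : Isogeny W W')

/-- **Silverman X.4.2(a) for an isogeny, counting form**: for an isogeny `φ : E → E'` of elliptic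
curves over a number field and `f = φ(K)` the induced map on rational points,
`#S^{(φ)}(E/K) = [E'(K) : φ(E(K))] · #ker (Ш(φ) : Ш(E/K) → Ш(E'/K))`
(from the exact sequence `0 → E'(K)/φ(E(K)) → S^{(φ)}(E/K) → Ш(E/K)[φ] → 0`: the Kummer map `δ`
has kernel `φ(E(K))` and image the kernel of `S^{(φ)} → H¹(K, E)`, whose image is
`Ш ∩ im (H¹(K, E[φ]) → H¹(K, E)) = Ш ∩ ker H¹(φ) = ker Ш(φ)`). `Nat.card` throughout (both sides are
finite, `finite_selmerGroup'`). [cite: SilvermanAEC2009, Thm. X.4.2(a) (p. 333)] -/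
theorem natCard_selmerGroup_eq (f : W.toAffine.Point →+ W'.toAffine.Point)
    (hf : ∀ P, W'.toGeomPoints (f P) = φ (W.toGeomPoints P)) :
    Nat.card φ.selmerGroup =
      f.range.index *
        Nat.card (shaMap φ.toAddMonoidHom φ.equivariant φ.hasLocalPointsMaps_toAddMonoidHom).ker := by
  letI := φ.kerAction
  obtain ⟨δ, hker, hrange⟩ := φ.exists_kummerMap f hf
  set ι := resH1Hom (ContinuousMonoidHom.id (Field.absoluteGaloisGroup K))
    φ.toAddMonoidHom.ker.subtype (fun _ _ ↦ rfl) with hιdef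
  set ρ : φ.selmerGroup →+ W.galH1 := ι.comp φ.selmerGroup.subtype with hρdef
  -- image of `ρ`: `Ш ∩ im ι = Ш ∩ ker H¹(φ)`
  have hρrange : ρ.range = W.sha ⊓ (galH1Map φ.toAddMonoidHom φ.equivariant).ker := by
    rw [hρdef, AddMonoidHom.range_comp, AddSubgroup.range_subtype, hιdef,
      φ.selmerGroup_eq_comap_sha, AddSubgroup.map_comap_eq, inf_comm,
      φ.range_kerH1ToH1_eq_ker_galH1Map]
  have h2 : Nat.card ρ.range =
      Nat.card (shaMap φ.toAddMonoidHom φ.equivariant φ.hasLocalPointsMaps_toAddMonoidHom).ker := by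
    rw [hρrange]
    refine Nat.card_congr
      { toFun := fun x ↦ ⟨⟨x.1, (AddSubgroup.mem_inf.mp x.2).1⟩, ?_⟩
        invFun := fun x ↦ ⟨(x.1 : W.galH1), AddSubgroup.mem_inf.mpr ⟨x.1.2, ?_⟩⟩
        left_inv := fun x ↦ Subtype.ext rfl
        right_inv := fun x ↦ Subtype.ext (Subtype.ext rfl) }
    · rw [AddMonoidHom.mem_ker, Subtype.ext_iff, coe_shaMap_apply]
      exact (AddSubgroup.mem_inf.mp x.2).2
    · have hx := x.2
      rw [AddMonoidHom.mem_ker, Subtype.ext_iff, coe_shaMap_apply] at hx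
      exact hx
  -- kernel of `ρ`: the image of `δ`
  have h1 : Nat.card ρ.ker = Nat.card δ.range := by
    rw [hrange]
    refine Nat.card_congr
      { toFun := fun x ↦ ⟨(x.1 : φ.galH1Ker), AddSubgroup.mem_inf.mpr ⟨x.1.2, ?_⟩⟩
        invFun := fun x ↦ ⟨⟨x.1, (AddSubgroup.mem_inf.mp x.2).1⟩, ?_⟩
        left_inv := fun x ↦ Subtype.ext (Subtype.ext rfl)
        right_inv := fun x ↦ Subtype.ext rfl }
    · have hx := x.2
      rw [AddMonoidHom.mem_ker] at hx
      exact hx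
    · rw [AddMonoidHom.mem_ker]
      exact (AddSubgroup.mem_inf.mp x.2).2
  have h3 : Nat.card δ.range = f.range.index := by
    rw [← Nat.card_congr (QuotientAddGroup.quotientKerEquivRange δ).toEquiv, hker,
      AddSubgroup.index_eq_card]
  calc Nat.card φ.selmerGroup = Nat.card ρ.ker * Nat.card ρ.range := by
        rw [AddSubgroup.card_eq_card_quotient_mul_card_addSubgroup ρ.ker, mul_comm,
          Nat.card_congr (QuotientAddGroup.quotientKerEquivRange ρ).toEquiv]
    _ = f.range.index *
        Nat.card (shaMap φ.toAddMonoidHom φ.equivariant φ.hasLocalPointsMaps_toAddMonoidHom).ker := by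
        rw [h1, h3, h2]

/-- `[E'(K) : φ(E(K))]` is finite (nonzero) for an isogeny of elliptic curves over a number field:
`deg φ · E'(K) = φ(φ̂(E'(K))) ⊆ φ(E(K))` (Silverman III.6.2(a)) and `E'(K)` is finitely generated
(Mordell–Weil, `addGroup_fg_point_holds`). Milne, *ADT*, I.§7, proof of Thm. 7.3 (finiteness of
`Coker f(K)`). [cite: SilvermanAEC2009, Thm. III.6.2(a) and Thm. VIII.6.7] -/
theorem index_range_pointHom_ne_zero (f : W.toAffine.Point →+ W'.toAffine.Point)
    (hf : ∀ P, W'.toGeomPoints (f P) = φ (W.toGeomPoints P)) : f.range.index ≠ 0 := by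
  obtain ⟨ψ, hψφ⟩ := φ.exists_dual_of_isElliptic
  obtain ⟨g, hg⟩ := ψ.exists_pointHom
  -- `f ∘ g = [deg φ]` on `E'(K)`
  have hφψ : ∀ Q : W'.geomPoints, φ (ψ Q) = (φ.degree : ℤ) • Q := fun Q ↦ by
    obtain ⟨P, rfl⟩ := φ.surjective Q
    rw [hψφ, map_zsmul]
  have hfg : ∀ Q, f (g Q) = φ.degree • Q := fun Q ↦ toGeomPoints_injective W' (by
    rw [hf, hg, hφψ, ← natCast_zsmul, map_zsmul])
  haveI : AddGroup.FG W'.toAffine.Point := addGroup_fg_point_holds W'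
  haveI : Finite (W'.toAffine.Point ⧸ f.range) := by
    refine AddCommGroup.finite_of_fg_torsion _ fun y ↦ ?_
    induction y using QuotientAddGroup.induction_on with
    | H Q =>
      rw [isOfFinAddOrder_iff_nsmul_eq_zero]
      refine ⟨φ.degree, φ.degree_pos, ?_⟩
      rw [← QuotientAddGroup.mk_nsmul, ← hfg, QuotientAddGroup.eq_zero_iff]
      exact ⟨g Q, rfl⟩
  exact AddSubgroup.index_ne_zero_of_finite

/-- **Silverman X.4.2(b) for an isogeny: `S^{(φ)}(E/K)` is finite** (elliptic curves over a number
field), here from the count: `[E'(K) : φE(K)]` is finite (Mordell–Weil + dual isogeny) and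
`ker Ш(φ) ⊆ Ш(E/K)[deg φ]` is finite (`finite_ker_shaMap`). (The source proves (b) directly by
unramifiedness outside `S`; the tree's `Isogeny.finite_selmerGroup` of
`IsogenySelmerGroupsCompositeProofs.lean` obtains it from BKLOS Lemma 9.1 for `K : Type`; this
version is universe-polymorphic in `K`.) [cite: SilvermanAEC2009, Thm. X.4.2(b) (p. 333)] -/
theorem finite_selmerGroup' : Finite φ.selmerGroup := by
  obtain ⟨f, hf⟩ := φ.exists_pointHom
  obtain ⟨ψ, hψφ⟩ := φ.exists_dual_of_isElliptic
  have hker : ((shaMap φ.toAddMonoidHom φ.equivariant φ.hasLocalPointsMaps_toAddMonoidHom).ker :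
      Set W.sha).Finite :=
    finite_ker_shaMap φ.toAddMonoidHom φ.equivariant φ.hasLocalPointsMaps_toAddMonoidHom
      ψ.toAddMonoidHom ψ.equivariant φ.degree_pos.ne' (fun P ↦ hψφ P)
  haveI := hker.to_subtype
  have hpos : 0 < Nat.card φ.selmerGroup := by
    rw [φ.natCard_selmerGroup_eq f hf]
    exact Nat.mul_pos (Nat.pos_of_ne_zero (φ.index_range_pointHom_ne_zero f hf)) Nat.card_pos
  exact Nat.finite_of_card_ne_zero hpos.ne'

end Count

end Isogeny

end WeierstrassCurve

end
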